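import Summits.ABC.IUTFork.Joshi.ATS1Thm1111Proof
import HarnessLib

/-!
# Joshi, *Arithmetic Teichmüller Spaces I* (arXiv 2106.11452 v4) Thm. 11.1.1 — the exhibited valuations are PAIRWISE
# inequivalent (proof-only strengthening of `ATS1Thm1111Proof.thm1111_main`)

Record file of the abc-iut cell, branch E (seat abc-iut-E-t25; rung LADDER-ABC:A2.E); answers the [J-I] reader's note I1 on
p433402 (abc-iut-E-t55, plan/E/t55/AUDIT-p433402.md): print's «uncountably many rank-one valuations … each … not equivalent to
the given valuation» (p.53 l.66–68) counts absolute values as functions; the family `|−|_{{t}} = |σ_{{t}}(−)|_K` of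
`ATS1Thm1111Proof` is moreover PAIRWISE INEQUIVALENT: all its members take the value `|p|_K` at `p`, so an equivalence
`|−|_{{t}} = |−|_{{t′}}^e` (Mathlib `AbsoluteValue.isEquiv_iff_exists_rpow_eq`) has `e = 1`, i.e. is an equality, and `t ↦ |−|_{{t}}`
is injective. TAKES NO SIDE on [IUTchIII] Cor. 3.12 or on any author; classical valuation theory over Mathlib; no new
definition, no hypothesis beyond those of `thm1111_main`.
-/

noncomputable section

namespace Summit.ABC.IUTFork.Joshi.ATS1.SchmidtValuations

/-- Two real absolute values on a field that AGREE at one element `a` with `0 < |a| < 1` are equivalent iff they are EQUAL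
(an equivalence is `w = v^e`, and `e = 1` at `a`). [folklore] -/
theorem isEquiv_iff_eq_of_apply_eq {K : Type} [Field K] {v w : AbsoluteValue K ℝ} {a : K} (ha0 : 0 < v a) (ha1 : v a < 1)
    (hvw : v a = w a) : v.IsEquiv w ↔ v = w := by
  refine ⟨fun h => ?_, fun h => h ▸ AbsoluteValue.IsEquiv.refl v⟩
  rw [AbsoluteValue.isEquiv_iff_exists_rpow_eq] at h
  obtain ⟨e, he, hfun⟩ := h
  have hae : v a ^ e = v a := by
    have := congrFun hfun a
    rwa [← hvw] at this
  have he1 : e = 1 := by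
    have hlog := congrArg Real.log hae
    rw [Real.log_rpow ha0] at hlog
    have hne : Real.log (v a) ≠ 0 := Real.log_ne_zero_of_pos_of_ne_one ha0 (ne_of_lt ha1)
    field_simp at hlog
    linarith [hlog]
  apply AbsoluteValue.ext
  intro x
  have hx := congrFun hfun x
  rw [he1, Real.rpow_one] at hx
  exact hx

section

variable (K : Type) [Field K] [CharZero K] {T : Set K} (hT : IsTranscendenceBasis ℚ ((↑) : T → K)) [IsAlgClosed K]
  (vK : AbsoluteValue K ℝ) {c : ℚ} (hc : c ≠ 0)

/-- The singleton-scaled pull-backs are pairwise distinct: `t ↦ |−|_{{t}}` is injective on the transcendence basis when `c = p`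
with `0 < |p|_K < 1` (evaluate at `t`: `|p|_K·|t|_K` versus `|t|_K`, `t ≠ 0`). [folklore] -/
theorem vS_singleton_injective {p : ℕ} (hp : (c : K) = p) (hp1 : vK (p : K) < 1) :
    Function.Injective fun t : T => vS K hT vK hc {t} := by
  intro t t' htt'
  by_contra hne
  have h1 : vS K hT vK hc {t} (t : K) = vK (p : K) * vK (t : K) := by
    rw [vS_apply, sigma_of_mem K hT hc (Set.mem_singleton t), map_mul, hp]
  have h2 : vS K hT vK hc {t'} (t : K) = vK (t : K) := by
    rw [vS_apply, sigma_of_not_mem K hT hc (fun h : t ∈ ({t'} : Set T) => hne (Set.mem_singleton_iff.1 h))]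
  have h12 : vS K hT vK hc {t} (t : K) = vS K hT vK hc {t'} (t : K) :=
    congrArg (fun v : AbsoluteValue K ℝ => v (t : K)) htt'
  rw [h1, h2] at h12
  have htne : vK (t : K) ≠ 0 := by
    rw [ne_eq, AbsoluteValue.eq_zero]
    exact hT.1.ne_zero t
  have : vK (p : K) = 1 := by
    field_simp at h12
    linarith [h12]
  exact absurd this (ne_of_lt hp1)

/-- … hence PAIRWISE INEQUIVALENT (all members agree with `|−|_K` at `p`). [folklore] -/
theorem not_isEquiv_vS_singleton {p : ℕ} (hp : (c : K) = p) (hp0 : 0 < vK (p : K)) (hp1 : vK (p : K) < 1) {t t' : T}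
    (htt' : t ≠ t') : ¬ (vS K hT vK hc {t}).IsEquiv (vS K hT vK hc {t'}) := by
  intro h
  have hagree : vS K hT vK hc {t} (p : K) = vS K hT vK hc {t'} (p : K) := by rw [vS_natCast, vS_natCast]
  have h0 : 0 < vS K hT vK hc {t} (p : K) := by rw [vS_natCast]; exact hp0
  have h1 : vS K hT vK hc {t} (p : K) < 1 := by rw [vS_natCast]; exact hp1
  exact htt' (vS_singleton_injective K hT vK hc hp hp1 ((isEquiv_iff_eq_of_apply_eq h0 h1 hagree).1 h))

end

/-- **[J-I] Thm. 11.1.1, PAIRWISE form, PROVED** (p.53 l.64 – p.54 l.34): for every `p ≠ 0` and every algebraically closed field `K`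
of characteristic `0` complete w.r.t. a non-archimedean `|−|_K` with `|p|_K < 1`, there is an uncountable set of absolute values
on `K` — each complete, non-archimedean, with `|p| < 1`, inequivalent to `|−|_K` — which are moreover PAIRWISE inequivalent.
[claim: Joshi2021ATS1, status: disputed] -/
theorem thm1111_pairwise {p : ℕ} (hp : p ≠ 0) (K : Type) [Field K] (vK : AbsoluteValue K ℝ) :
    CharZero K → IsAlgClosed K → CompleteSpace (WithAbs vK) → IsNonarchimedean vK → vK (p : K) < 1 →
      ∃ S : Set (AbsoluteValue K ℝ), ¬ S.Countable ∧
        (∀ v ∈ S, CompleteSpace (WithAbs v) ∧ IsNonarchimedean v ∧ v (p : K) < 1 ∧ ¬ v.IsEquiv vK) ∧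
        S.Pairwise fun v w => ¬ v.IsEquiv w := by
  intro hcz halg hcs hna hvp
  have hpK : (p : K) ≠ 0 := Nat.cast_ne_zero.2 hp
  have hp0 : 0 < vK (p : K) := vK.pos hpK
  obtain ⟨T, hT⟩ := exists_isTranscendenceBasis ℚ K
  have hc : (p : ℚ) ≠ 0 := Nat.cast_ne_zero.2 hp
  have hcK : ((p : ℚ) : K) = (p : K) := by push_cast; rfl
  let f : T → AbsoluteValue K ℝ := fun t => vS K hT vK hc {t}
  have hf : Function.Injective f := vS_singleton_injective K hT vK hc hcK hvp
  refine ⟨Set.range f, ?_, ?_, ?_⟩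
  · intro hcount
    haveI := hcount.to_subtype
    have hinj : Function.Injective (Set.rangeFactorization f) := fun a b h => hf (congrArg Subtype.val h)
    exact not_countable_basis K hT (not_countable_of_complete K vK hp0 hvp) hinj.countable
  · rintro v ⟨t, rfl⟩
    refine ⟨completeSpace_vS K hT vK hc {t}, isNonarchimedean_vS K hT vK hc hna {t}, ?_, ?_⟩
    · change vS K hT vK hc {t} (p : K) < 1
      rw [vS_natCast]
      exact hvp
    · exact not_isEquiv_vS K hT vK hc hcK hp0 hvp (Set.mem_singleton t)
  · rintro v ⟨t, rfl⟩ w ⟨t', rfl⟩ hvw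
    exact not_isEquiv_vS_singleton K hT vK hc hcK hp0 hvp fun h => hvw (by rw [h])

end Summit.ABC.IUTFork.Joshi.ATS1.SchmidtValuations

end
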